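import Summits.NavierStokesRegularity.NavierStokesRegularity.Theorems.FilamentSkeletonRssSkeletonJ1RSplit

/-!
# Route `FilamentSkeletonRss` · crux `SkeletonJ1R` (stmt-23610) · line `lia_switchoff_degree_R` — COMPANION: THE INTENDED FRAME

The skeleton `Lines/lia_switchoff_degree_R.lean` leaves the frame `(x, M)` to the confinement prover (`∃` in `ConfinementL`).  This file
TYPES the intended reference — the LOCAL-INDUCTION (LIA / binormal) REFERENCE SKELETON — and records the two elementary facts about its
cutoff that the design depends on.  Nothing here is load-bearing for the skeleton; it is the recommended first `--supports` target of the
confinement prover (`LiaReferenceAdmissible` below, informal).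

DESIGN RULE (why the cutoff is NOT the switch weight).  On the reference the outer model is tangent, so switched tangency at homotopy time `s`
reads `σ_s(x)·(β_j x′×x″ + W_j(x)⊥) = 0`: FULL local-induction balance wherever `σ_s > 0`, nothing where `σ_s = 0`.  Hence the reference
must solve `x″ = β_j⁻¹ · φ(x) · x′ × W_j(x)` with a cutoff `φ = 1` on the CLOSED FINAL switched region `‖y‖² ≤ 2ℓ²` (`ℓ = Rb√(Γ log Γ)`),
and may straighten only beyond it; we take `φ(y) = χ(‖y‖²/ℓ² − 2) = switchWeight ℓ (3/2) y` (`= 1` for `‖y‖² ≤ 2ℓ²`, `= 0` for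
`‖y‖² ≥ 3ℓ²`).  The same curve serves for EVERY `s ∈ [0,1]` (the switched region at time `s`, `‖y‖² < 2sℓ²`, is inside `‖y‖² ≤ 2ℓ²`), so
the frame is constant along the homotopy.  A `σ_s`-weighted reference would under-bend in the collar by a tilt `≈ 0.4·A·Rb²` and miss the
true skeleton by `≈ 0.16·A·Rb³·√(log Γ)·√Γ ≫ Rb√Γ` — the same defect, one order down, as the straight tubes of `switchoff_degree_R`.

NUMBERS (GP datum `straightDatumGP_exists`: `γ_j = 125π/108`, `α = 875/432`, `|e₃ × t_j| = 3/5`; `A = 4π α |e₃×t_j| / γ_j ≈ 4.2`):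
`β_j = Γ γ_j log Γ / (8π)`; S-bend curvature `|x″| ≈ α|e₃×t_j|·|τ|/β_j ≤ 2A·Rb/(√Γ·√(log Γ))` on the ball; turning per arm `A·Rb²`;
odd normal displacement at the ball edge `(A/3)·Rb³·√(log Γ)·√Γ`.  Admissibility (`AdmissibleReference` of the skeleton: tilt `≤ Rb/8`,
curvature `√Γ|x″| ≤ Rb/2`) therefore wants `Rb ≤ 1/(8A)` and `log Γ ≥ 16A²`.
-/

set_option linter.dupNamespace false
set_option linter.unusedVariables false

noncomputable section

namespace Summit.NavierStokesRegularity.NavierStokesRegularity.Cruxes.SkeletonJ1R.LiaSwitchoffDegreeR.Frame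

open Set Function Filter MeasureTheory Real
open Literature.Analysis.FluidPDE
open scoped InnerProductSpace Topology BigOperators

/-- Smooth switch profile (verbatim from the skeleton): `= 1` on `(-∞, 0]`, `= 0` on `[1, ∞)`. -/
def switchProfile (x : ℝ) : ℝ := Real.smoothTransition (1 - x)

/-- Switch weight at homotopy time `s` (verbatim from the skeleton): `χ(‖y‖²/ℓ² + 1 − 2s)`. -/
def switchWeight (ℓ s : ℝ) (y : EuclideanSpace ℝ (Fin 3)) : ℝ := switchProfile (‖y‖ ^ 2 / ℓ ^ 2 + 1 - 2 * s)

/-- Scaled datum waist point `√Γ • (p j + s₀ j • t j)` (verbatim from the skeleton). -/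
def waistPt {N : ℕ} (Γ : ℝ) (p t : Fin N → EuclideanSpace ℝ (Fin 3)) (s₀ : Fin N → ℝ) (j : Fin N) : EuclideanSpace ℝ (Fin 3) :=
  Real.sqrt Γ • (p j + s₀ j • t j)

/-- Scaled straight datum line `k`, parametrised by arclength from its waist point: `√Γ(p k + s₀ k • t k) + σ • t k`. -/
def datumLine {N : ℕ} (Γ : ℝ) (p t : Fin N → EuclideanSpace ℝ (Fin 3)) (s₀ : Fin N → ℝ) (k : Fin N) (σ : ℝ) : EuclideanSpace ℝ (Fin 3) :=
  waistPt Γ p t s₀ k + σ • t k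

/-- The AMBIENT field seen by filament `j` in the reference problem: regularised Biot–Savart field (unit cores, the crux's kernel) of the
OTHER scaled straight datum lines, plus the frame field `½ y − α e₃ × y`.  (No self term: the self-induction of the reference is the
local-induction term `β_j x′ × x″`, which `IsLiaReference` solves for.) -/
def ambientField {N : ℕ} (Γ : ℝ) (p t : Fin N → EuclideanSpace ℝ (Fin 3)) (γ : Fin N → ℝ) (α : ℝ) (s₀ : Fin N → ℝ) (j : Fin N)
    (y : EuclideanSpace ℝ (Fin 3)) : EuclideanSpace ℝ (Fin 3) :=
  (∑ k ∈ Finset.univ.erase j, (Γ*γ k/(4*Real.pi)) • ∫ σ:ℝ,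
      ((‖y - datumLine Γ p t s₀ k σ‖^2+Real.exp (-(1+Real.eulerMascheroniConstant-Real.log 2))*(1:ℝ))^(3/2:ℝ))⁻¹ •
        cross (t k) (y - datumLine Γ p t s₀ k σ)) +
    (1/2:ℝ) • y - α • cross (EuclideanSpace.single 2 1) y

/-- The local-induction (binormal) coefficient of filament `j` with a matched unit core at outer scale `√Γ`:
`β_j = (Γγ_j/4π)·(½ log Γ) = Γ γ_j log Γ/(8π)`.  (Any `O(log log Γ)` refinement of the logarithm changes the S-bend displacement by
`o(√Γ)` only; the prover may refine it.) -/
def liaCoeff {N : ℕ} (Γ : ℝ) (γ : Fin N → ℝ) (j : Fin N) : ℝ := Γ * γ j * Real.log Γ / (8 * Real.pi)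

/-- The reference CUTOFF: `φ(y) = χ(‖y‖²/ℓ² − 2)` — equal to `1` on the closed final switched region `‖y‖² ≤ 2ℓ²` and to `0` for
`‖y‖² ≥ 3ℓ²` (it is the switch weight at the fictitious time `s = 3/2`). -/
def refCutoff (ℓ : ℝ) (y : EuclideanSpace ℝ (Fin 3)) : ℝ := switchWeight ℓ (3/2) y

/-- THE LIA REFERENCE SKELETON: unit-speed `C²` curves shot from the scaled datum waists in the datum directions, solving the cut-off
local-induction tangency equation `x_j″ = β_j⁻¹ · φ(x_j) · x_j′ × W_j(x_j)` (`x′ × (x′ × x″) = −x″` at unit speed turns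
`β_j x′×x″ = −W_j⊥` into this form).  It carries the full strain-driven S-bend on `‖y‖ ≤ √2·ℓ` and is straight beyond `‖y‖ ≥ √3·ℓ`.  An IVP:
the right side is orthogonal to `x_j′`, so unit speed propagates, and it has linear growth, so the solution is global and unique. -/
def IsLiaReference {N : ℕ} (Γ Rb : ℝ) (p t : Fin N → EuclideanSpace ℝ (Fin 3)) (γ : Fin N → ℝ) (α : ℝ) (s₀ : Fin N → ℝ)
    (x : Fin N → ℝ → EuclideanSpace ℝ (Fin 3)) : Prop :=
  ∀ j, ContDiff ℝ 2 (x j) ∧ (∀ τ, ‖deriv (x j) τ‖ = 1) ∧ x j 0 = waistPt Γ p t s₀ j ∧ deriv (x j) 0 = t j ∧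
    ∀ τ, iteratedDeriv 2 (x j) τ =
      ((liaCoeff Γ γ j)⁻¹ * refCutoff (Rb * Real.sqrt (Γ * Real.log Γ)) (x j τ)) •
        cross (deriv (x j) τ) (ambientField Γ p t γ α s₀ j (x j τ))

/-- RECOMMENDED FIRST SUPPORT LEMMA for the confinement prover (informal; a `def … : Prop` so that it can be cited, not a stub):
for a general-position straight datum there are `Rb₁ > 0` and, for every `0 < Rb ≤ Rb₁`, a `Γ₁` such that for all `Γ ≥ Γ₁` the LIA reference
exists, is unique, and is an ADMISSIBLE REFERENCE in the sense of the skeleton: tilt `‖x_j′ τ − t j‖ ≤ Rb/8`, curvature `√Γ‖x_j″‖ ≤ Rb/2`,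
separation `(ρ/2)√Γ`, injective normal tubes of radius `ρ√Γ/8`.  Stated here with the bounds inlined. -/
def LiaReferenceAdmissible : Prop :=
  ∀ (N : ℕ) (ρ θd : ℝ) (p t : Fin N → EuclideanSpace ℝ (Fin 3)) (γ : Fin N → ℝ) (α : ℝ) (s₀ : Fin N → ℝ),
    0 < ρ → 0 < θd → (∀ j, ‖t j‖ = 1) → (∀ j, γ j ≠ 0) →
    (∀ j k, j ≠ k → ∀ σ σ' : ℝ, ρ ≤ ‖(p j + σ • t j) - (p k + σ' • t k)‖) → (∀ j k, j ≠ k → |⟪t j, t k⟫_ℝ| ≤ 1 - θd) →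
    ∃ Rb₁ : ℝ, 0 < Rb₁ ∧ ∀ Rb : ℝ, 0 < Rb → Rb ≤ Rb₁ → ∃ Γ₁ : ℝ, ∀ Γ : ℝ, Γ₁ ≤ Γ →
      ∃ x : Fin N → ℝ → EuclideanSpace ℝ (Fin 3), IsLiaReference Γ Rb p t γ α s₀ x ∧
        (∀ j τ, ‖deriv (x j) τ - t j‖ ≤ Rb / 8) ∧ (∀ j τ, ‖iteratedDeriv 2 (x j) τ‖ * Real.sqrt Γ ≤ Rb / 2) ∧
        (∀ j k, j ≠ k → ∀ τ σ, ρ / 2 * Real.sqrt Γ ≤ ‖x j τ - x k σ‖) ∧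
        (∀ j k τ σ (z z' : EuclideanSpace ℝ (Fin 3)), ⟪z, deriv (x j) τ⟫_ℝ = 0 → ⟪z', deriv (x k) σ⟫_ℝ = 0 →
          ‖z‖ ≤ ρ * Real.sqrt Γ / 8 → ‖z'‖ ≤ ρ * Real.sqrt Γ / 8 → x j τ + z = x k σ + z' → j = k ∧ τ = σ ∧ z = z')

/-! ## Elementary facts about the cutoff (sorry-free) -/

/-- The cutoff is `1` on the closed final switched region `‖y‖² ≤ 2ℓ²` (`ℓ ≠ 0`). -/
theorem refCutoff_eq_one {ℓ : ℝ} (hℓ : ℓ ≠ 0) {y : EuclideanSpace ℝ (Fin 3)} (hy : ‖y‖ ^ 2 ≤ 2 * ℓ ^ 2) : refCutoff ℓ y = 1 := by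
  unfold refCutoff switchWeight switchProfile
  apply Real.smoothTransition.one_of_one_le
  have hℓ2 : 0 < ℓ ^ 2 := by positivity
  have : ‖y‖ ^ 2 / ℓ ^ 2 ≤ 2 := by
    rw [div_le_iff₀ hℓ2]; linarith
  linarith

/-- The cutoff vanishes for `‖y‖² ≥ 3ℓ²` (`ℓ ≠ 0`): the reference is straight there. -/
theorem refCutoff_eq_zero {ℓ : ℝ} (hℓ : ℓ ≠ 0) {y : EuclideanSpace ℝ (Fin 3)} (hy : 3 * ℓ ^ 2 ≤ ‖y‖ ^ 2) : refCutoff ℓ y = 0 := by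
  unfold refCutoff switchWeight switchProfile
  apply Real.smoothTransition.zero_of_nonpos
  have hℓ2 : 0 < ℓ ^ 2 := by positivity
  have : 3 ≤ ‖y‖ ^ 2 / ℓ ^ 2 := by
    rw [le_div_iff₀ hℓ2]; linarith
  linarith

/-- The switched region at any time `s ≤ 1` lies inside the region where the cutoff is `1`: if the switch weight is positive at `y` then
`‖y‖² < 2sℓ² ≤ 2ℓ²`, hence `refCutoff ℓ y = 1` — the design rule of the header. -/
theorem refCutoff_eq_one_of_switchWeight_pos {ℓ s : ℝ} (hℓ : ℓ ≠ 0) (hs : s ≤ 1) {y : EuclideanSpace ℝ (Fin 3)}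
    (hy : 0 < switchWeight ℓ s y) : refCutoff ℓ y = 1 := by
  apply refCutoff_eq_one hℓ
  have hℓ2 : 0 < ℓ ^ 2 := by positivity
  by_contra h
  push Not at h
  have h1 : 1 ≤ ‖y‖ ^ 2 / ℓ ^ 2 + 1 - 2 * s := by
    have : 2 < ‖y‖ ^ 2 / ℓ ^ 2 := by rw [lt_div_iff₀ hℓ2]; linarith
    linarith
  have : switchWeight ℓ s y = 0 := by
    unfold switchWeight switchProfile
    exact Real.smoothTransition.zero_of_nonpos (by linarith)
  linarith

/-- Where the cutoff is `1` the reference equation is the FULL local-induction balance; in particular, by the previous lemma, wherever the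
true field is switched on at all (any `s ≤ 1`). -/
theorem liaReference_full_balance {N : ℕ} {Γ Rb : ℝ} {p t : Fin N → EuclideanSpace ℝ (Fin 3)} {γ : Fin N → ℝ} {α : ℝ}
    {s₀ : Fin N → ℝ} {x : Fin N → ℝ → EuclideanSpace ℝ (Fin 3)} (hx : IsLiaReference Γ Rb p t γ α s₀ x) (j : Fin N) (τ : ℝ)
    (hcut : refCutoff (Rb * Real.sqrt (Γ * Real.log Γ)) (x j τ) = 1) :
    iteratedDeriv 2 (x j) τ = (liaCoeff Γ γ j)⁻¹ • cross (deriv (x j) τ) (ambientField Γ p t γ α s₀ j (x j τ)) := by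
  obtain ⟨_, _, _, _, hode⟩ := hx j
  rw [hode τ, hcut, mul_one]

end Summit.NavierStokesRegularity.NavierStokesRegularity.Cruxes.SkeletonJ1R.LiaSwitchoffDegreeR.Frame

end
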